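import Summits.ABC.IUTFork.Conditional.AbcOfSGenuineKTameRobustRatPoint
import Summits.ABC.IUTFork.Cor312SzpiroBadVsDepthPoint
import Literature.IUT.LogVolume.Corollary22PartIIUpTo
import Literature.NumberTheory.DiophantineGeometry.AbcWave0UniformABCProofs
import HarnessLib

/-!
# R-W lane U, task T4 on the TAME stratum: at a SZPIRO-BAD admissible RATIONAL `(λ, l ≥ 7)` the hull-level clause S_H FAILS for
# every Θ-volume datum whose HEAVIEST bad fibre is lattice-tame — uniformly (composition of abc-iut-w4-d078's averaging and
# abc-iut-w5-d107's robust tame-exact decider; no new engine)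

PROOF-ONLY file (no `def`, no new `Prop`, no `instance`) of the abc-iut cell (WAVE-5 prover seat abc-iut-w5-d009, gen 11; D-0079 R-W
«WINDOW Θ-SIDE INEQUALITY», lane U, claim «W:T4-TAME», HOME/STATUS 2026-08-26T18:1xZ; `plan/W/WINDOW-SPEC.md` §2b/§2f). TAKES NO SIDE on
[IUTchIII] Cor. 3.12 (S. Mochizuki, *Inter-universal Teichmüller theory III*, RIMS manuscript = PRIMS **57** (2021), Cor. 3.12 p. 173–174,
Step (xi-f) p. 184) or on any author.

THE QUESTION (task T4 of the R-W spec, tame stratum). The window binder `hSHwBad` of the branch-C certificates of record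
(`Conditional.abc_of_SH_v10K_window_szpiroBadBoth` p450130 / `…szpiroBadAll` p453137) demands the hull-level clause S_H (chosen realising
ideles, pinned reading) at every admissible `(P, l)` that is SZPIRO-BAD — «`(l+5)/4 < d_mod ∨ c₁·(log-diff + (1−1/l)·log 𝔣^{∤2l}) + c₂·log π <
log q^{∤2l}`», `c₁ = 6l(l+5−4d_mod)/((l+4)(l−3))` — and off the degree-form depth locus. abc-iut-w4-d078 (`Cor312SzpiroBadVsDepth`, p457542)
showed the Szpiro-bad disjunct yields, place by place, only «SOME bad `v ∤ 2l` has local height `h_v > c₁(1−1/l)`» (`≤ 8`), which does not force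
depth. THIS FILE records what it DOES force on the tame stratum at RATIONAL points: the heavy place is heavy enough for abc-iut-w5-d107's robust
tame-exact decider at the top label (`GenuineK.not_pilotKummerCompatHull_chosen_ratPoint_of_tame_robust_top`, p460144: a pole of order `h`
with `4l ≤ (l−3)·h` over ONE lattice-tame place refutes S_H), for EVERY `l ≥ 7`.

WHAT IS PROVED.
* §1 `Cor22.four_mul_le_of_szpiroCoeff_lt` — integer rounding: for `7 ≤ l` and a natural number `h` with `c₁(l,1)·(1−1/l) =
  6(l²−1)/((l+4)(l−3)) < h`: **`4l ≤ (l−3)·h`** (`c > 5` always, so `h ≥ 6`, enough for `l ≥ 9`; `c > 6` for `l ≤ 10`, so `h ≥ 7`, enough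
  for `l ∈ {7, 8}`). At `l = 5` the rounding gives only `h ≥ 9 < 10 = 4l/(l−3)`: the one admissible prime NOT covered.
* §2 `Cor22.exists_heavy_badPlace_of_szpiroBad_ratPoint` — at `P = ratPoint λ` (`d_mod = 1`, `Cor22.dmod_eq_one_of_degree_le_one`), `7 ≤ l`, the
  Szpiro-bad disjunction (binder text of the records, `P ↦ ratPoint λ`; its first disjunct is impossible) yields a bad place `v ∤ 2l` of `ℚ`
  with **`4l ≤ (l−3)·h_v`**, `h_v = −ord_v j(λ) ≥ 1`.
* §3 **`GenuineK.not_pilotKummerCompatHull_chosen_ratPoint_of_szpiroBad_tame`** — for EVERY genuine Θ-volume datum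
  `T : Cor22.ThetaVolumeDatumAt (ratPoint λ) l`, `l ≥ 7`, `(ratPoint λ, l)` Szpiro-bad: IF at every HEAVY bad prime `p ∤ 2l` of `λ`
  (`4l ≤ (l−3)·h_p`) some place `x₀ | p` of `T.K` is lattice-tame (`e(K_{x₀}/ℚ_p) ≤ p − 2` — the LOCAL-TYPE BINDER; abc-iut-W-neg-1's
  local-type lemma and abc-iut-w5-d163's `GenuineK.absRamificationIdx_kOf_le_ratPoint` discharge it by class), THEN the hull-level clause S_H at
  the genuine sharp setting over `T.K` (CHOSEN realising ideles, PINNED reading — verbatim the per-datum object of `hSHw`/`hSHwBad`) FAILS, for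
  every choice of the free context binders and Kummer datum.
* §4 `…_of_szpiroBad_of_large_heavy_primes` — the binder DISCHARGED when every heavy bad prime `p ∤ 2l` has `46080·l ≤ p − 2`: then NO datum at
  a Szpiro-bad `(ratPoint λ, l ≥ 7)` carries S_H — no hypothesis on the datum at all.

READING for letters C/W (numbers, no side): at a Szpiro-bad admissible RATIONAL `(P, l ≥ 7)` the window binder `hSHwBad` can be served ONLY by
data whose heaviest bad fibre (`h_p ≥ 6`) is WILD (`e(K_{x₀}/ℚ_p) ≥ p − 1` at every `x₀ | p`, stratum U2 of WINDOW-SPEC §2): the strata U1/U1½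
contribute nothing there, for any `l ≥ 7`. Per-datum refutations of `hSHwBad` at known rational data (task «C:HSHW-REF») are instances of §3
plus admissibility, (P6), shallowness and non-emptiness of the datum type — none of which is claimed here. HONEST SCOPE (w5-d107's, binding):
SHARP reading; per-label licence STRONGER than print; nothing about the printed GLOBAL inequality, the NUMBER-level Corollary or any author's
intended hull; «refuted as typed» ≠ «refuted in print»; typed ≠ proved; instantiated ≠ endorsed.
[cite: Mochizuki2012, IUTchIII Cor. 3.12 p. 173–174, Step (xi-f) p. 184; IUTchIV Thm. 1.10 p. 22–23, Cor. 2.2 (ii) proof (P2)(P5) p. 45–46]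
[cite: DupuyHilado2025, §3.3, §3.4, §4.9] [claim: Mochizuki2012, status: disputed] for every IUT sentence quoted.
-/

noncomputable section

open Set Function NumberField IsDedekindDomain

/-! ## §1. Integer rounding of the Szpiro-bad per-place threshold: `c₁(l,1)(1−1/l) < h ⇒ 4l ≤ (l−3)·h` for `l ≥ 7` -/

namespace Literature.IUT.LogVolume.Cor22

open Literature.NumberTheory.DiophantineGeometry.GenEll

/-- **Rounding the Szpiro-bad per-place threshold at `d_mod = 1`.** For `7 ≤ l` and a natural number `h` with
`(6l((l+5)−4·1)/((l+4)(l−3)))·(1−1/l) < h` — i.e. `6(l+1)(l−1)/((l+4)(l−3)) < h` — one has `4l ≤ (l−3)·h`: the coefficient exceeds `5`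
(so `h ≥ 6`, which suffices for `l ≥ 9`) and exceeds `6` when `l ≤ 10` (so `h ≥ 7`, which suffices for `l ∈ {7, 8}`). [folklore] -/
theorem four_mul_le_of_szpiroCoeff_lt {l h : ℕ} (h7 : 7 ≤ l)
    (hlt : 6 * l * (((l : ℝ) + 5) - 4 * ((1 : ℕ) : ℝ)) / (((l : ℝ) + 4) * ((l : ℝ) - 3)) * (1 - 1 / (l : ℝ)) < (h : ℝ)) :
    4 * l ≤ (l - 3) * h := by
  have hl7 : (7 : ℝ) ≤ l := by exact_mod_cast h7
  have hl0 : (0 : ℝ) < l := by linarith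
  have hD : (0 : ℝ) < ((l : ℝ) + 4) * ((l : ℝ) - 3) := mul_pos (by linarith) (by linarith)
  have e : 6 * l * (((l : ℝ) + 5) - 4 * ((1 : ℕ) : ℝ)) / (((l : ℝ) + 4) * ((l : ℝ) - 3)) * (1 - 1 / (l : ℝ)) =
      6 * ((l : ℝ) + 1) * ((l : ℝ) - 1) / (((l : ℝ) + 4) * ((l : ℝ) - 3)) := by
    have h1 : (1 - 1 / (l : ℝ)) = ((l : ℝ) - 1) / l := by field_simp
    rw [h1, Nat.cast_one, div_mul_div_comm, div_eq_div_iff (mul_pos hD hl0).ne' hD.ne']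
    ring
  rw [e] at hlt
  -- the coefficient exceeds `5`, so `h ≥ 6`
  have h5 : (5 : ℝ) < 6 * ((l : ℝ) + 1) * ((l : ℝ) - 1) / (((l : ℝ) + 4) * ((l : ℝ) - 3)) := by
    rw [lt_div_iff₀ hD]; nlinarith [sq_nonneg ((l : ℝ) - 3)]
  have hh6 : 6 ≤ h := by
    have h' : (5 : ℝ) < (h : ℝ) := h5.trans hlt
    have h'' : 5 < h := by exact_mod_cast h'
    omega
  by_cases hl11 : 11 ≤ l
  · calc 4 * l ≤ (l - 3) * 6 := by omega
      _ ≤ (l - 3) * h := Nat.mul_le_mul_left _ hh6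
  · -- `7 ≤ l ≤ 10`: the coefficient exceeds `6`, so `h ≥ 7`
    have hl10 : (l : ℝ) ≤ 10 := by exact_mod_cast (show l ≤ 10 by omega)
    have h6 : (6 : ℝ) < 6 * ((l : ℝ) + 1) * ((l : ℝ) - 1) / (((l : ℝ) + 4) * ((l : ℝ) - 3)) := by
      rw [lt_div_iff₀ hD]; nlinarith
    have hh7 : 7 ≤ h := by
      have h' : (6 : ℝ) < (h : ℝ) := h6.trans hlt
      have h'' : 6 < h := by exact_mod_cast h'
      omega
    calc 4 * l ≤ (l - 3) * 7 := by omega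
      _ ≤ (l - 3) * h := Nat.mul_le_mul_left _ hh7

/-! ## §2. The heavy bad place of a Szpiro-bad RATIONAL point -/

/-- **A Szpiro-bad rational point has a HEAVY bad place: `4l ≤ (l−3)·h_v` at some bad `v ∤ 2l`.** At `P = ratPoint λ` (`d_mod = 1`) with
`7 ≤ l`, the Szpiro-bad disjunction of the window records (binder text of `Conditional.abc_of_SH_v10K_window_szpiroBadBoth`, p450130, with
`P ↦ ratPoint λ`; the disjunct `(l+5)/4 < d_mod` is impossible) forces a pole `v` of `j(λ)`, `v ∤ 2l`, whose order `h_v = −ord_v j(λ) ≥ 1`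
satisfies `4l ≤ (l−3)·h_v` (abc-iut-w4-d078's `exists_localHeight_gt_of_szpiroBad` + §1).
[cite: Mochizuki2012, IUTchIV Cor. 2.2 (ii) proof (P2)(P5) p. 45–46] [claim: Mochizuki2012, status: disputed] -/
theorem exists_heavy_badPlace_of_szpiroBad_ratPoint (q : ℚ) {l : ℕ} (h7 : 7 ≤ l)
    (hbad : ((l : ℝ) + 5) / 4 < (dmod (ratPoint q) : ℝ) ∨
        6 * l * (((l : ℝ) + 5) - 4 * dmod (ratPoint q)) / (((l : ℝ) + 4) * ((l : ℝ) - 3))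
            * ((ratPoint q).logDiff + (1 - 1 / (l : ℝ)) * logCondAvoid (ratPoint q) {2, l})
          + 6 * l * ((l : ℝ) + 5) / (((l : ℝ) + 4) * ((l : ℝ) - 3)) * Real.log Real.pi < logQAvoid (ratPoint q) {2, l}) :
    ∃ v : HeightOneSpectrum (𝓞 ℚ), v ∈ badPlaces (ratPoint q) ∧ ((2 : ℕ) : 𝓞 ℚ) ∉ v.asIdeal ∧ ((l : ℕ) : 𝓞 ℚ) ∉ v.asIdeal ∧
      ord ℚ v (jInv q) = -(((-(ord ℚ v (jInv q))).toNat : ℕ) : ℤ) ∧ 1 ≤ (-(ord ℚ v (jInv q))).toNat ∧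
      4 * l ≤ (l - 3) * (-(ord ℚ v (jInv q))).toNat := by
  have hd : dmod (ratPoint q) = 1 := dmod_eq_one_of_degree_le_one (by rw [degree_ratPoint])
  have h5 : 5 ≤ l := by omega
  have hl7 : (7 : ℝ) ≤ l := by exact_mod_cast h7
  -- the conclusion for a place `v` of `ℚ` presented with the standard instance path (`(ratPoint q).F = ℚ` by `rfl`)
  have key : ∀ v : HeightOneSpectrum (𝓞 ℚ), v ∈ badPlaces (ratPoint q) →
      6 * l * (((l : ℝ) + 5) - 4 * ((1 : ℕ) : ℝ)) / (((l : ℝ) + 4) * ((l : ℝ) - 3)) * (1 - 1 / (l : ℝ)) <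
        ((-(ord ℚ v (jInv q))).toNat : ℝ) →
      ord ℚ v (jInv q) = -(((-(ord ℚ v (jInv q))).toNat : ℕ) : ℤ) ∧ 1 ≤ (-(ord ℚ v (jInv q))).toNat ∧
        4 * l ≤ (l - 3) * (-(ord ℚ v (jInv q))).toNat := by
    intro v hv hlt
    have hneg : ord ℚ v (jInv q) < 0 := (mem_badPlaces_iff_ord_neg (ratPoint q) v).mp hv
    have hto : ((-(ord ℚ v (jInv q))).toNat : ℤ) = -(ord ℚ v (jInv q)) := Int.toNat_of_nonneg (by omega)
    exact ⟨by omega, by omega, four_mul_le_of_szpiroCoeff_lt h7 hlt⟩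
  rcases hbad with hbad | hbad
  · exfalso
    rw [hd, Nat.cast_one] at hbad
    linarith
  · have hdle : (dmod (ratPoint q) : ℝ) ≤ ((l : ℝ) + 5) / 4 := by
      rw [hd, Nat.cast_one]; linarith
    obtain ⟨v, hv, h2, hl, hlt⟩ := exists_localHeight_gt_of_szpiroBad (P := ratPoint q) h5 hdle hbad
    rw [hd] at hlt
    exact ⟨v, hv, h2, hl, key v hv hlt⟩

end Literature.IUT.LogVolume.Cor22

/-! ## §3. Every datum at a Szpiro-bad rational `(λ, l ≥ 7)` whose heavy bad fibres are lattice-tame FAILS S_H -/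

namespace Summit.ABC.IUTFork.Conditional

open Thm311 Thm311.Real Cor312 Cor312Vol Cor312Prov Literature.IUT.LogThetaLattice Literature.IUT.LogVolume
  Literature.IUT.HodgeTheaters Literature.IUT.LogVolume.ThetaData Literature.IUT.LogVolume.Cor22
open Literature.NumberTheory.NumberFields Literature.NumberTheory.GaloisRepresentations.Ultrametric
open Literature.NumberTheory.DiophantineGeometry.GenEll Summit.ABC.ABC.Theorems

/-- **SZPIRO-BAD ∧ HEAVY-FIBRE-TAME ⟹ ¬ S_H, UNIFORMLY IN THE DATUM.** `λ ∈ ℚ`, `7 ≤ l`, `(ratPoint λ, l)` Szpiro-bad (the disjunction of the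
window records verbatim, `P ↦ ratPoint λ`), `T` ANY genuine Θ-volume datum at `(ratPoint λ, l)`. LOCAL-TYPE BINDER: at every HEAVY bad prime
`p ∤ 2l` of `λ` — a pole `v` of `j(λ)` with `4l ≤ (l−3)·h_v` — some place `x₀ | p` of `T.K` has `e(K_{x₀}/ℚ_p) ≤ p − 2`. THEN the hull-level
clause S_H at the genuine sharp setting over `T.K` (CHOSEN realising ideles, PINNED reading) FAILS for every choice of the free context binders
and Kummer datum: the heavy place of §2 feeds abc-iut-w5-d107's `…_ratPoint_of_tame_robust_top`. Sharp reading; refuted-as-typed only.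
[cite: Mochizuki2012, IUTchIV Cor. 2.2 (ii) proof (P5) p. 46; IUTchIII Cor. 3.12 Step (xi-f) p. 184] [claim: Mochizuki2012, status: disputed] -/
theorem GenuineK.not_pilotKummerCompatHull_chosen_ratPoint_of_szpiroBad_tame {q : ℚ} {l : ℕ}
    (T : Cor22.ThetaVolumeDatumAt (ratPoint q) l) (h7 : 7 ≤ l)
    (hbad : ((l : ℝ) + 5) / 4 < (Cor22.dmod (ratPoint q) : ℝ) ∨
        6 * l * (((l : ℝ) + 5) - 4 * Cor22.dmod (ratPoint q)) / (((l : ℝ) + 4) * ((l : ℝ) - 3))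
            * ((ratPoint q).logDiff + (1 - 1 / (l : ℝ)) * Cor22.logCondAvoid (ratPoint q) {2, l})
          + 6 * l * ((l : ℝ) + 5) / (((l : ℝ) + 4) * ((l : ℝ) - 3)) * Real.log Real.pi < Cor22.logQAvoid (ratPoint q) {2, l})
    (htame : letI := T.instFieldF; letI := T.instNumberFieldF; letI := T.instAlgebraF; letI := T.instFieldK
      letI := T.instNumberFieldK; letI := T.instAlgebraK; letI := T.instFieldFbar; letI := T.instAlgebraFbar
      letI := T.instAlgebraKFbar; letI := T.instIsElliptic
      ∀ (pp : Nat.Primes), (pp : ℕ) ≠ 2 → (pp : ℕ) ≠ l →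
        ∀ v : HeightOneSpectrum (𝓞 ℚ), v ∈ Cor22.badPlaces (ratPoint q) → Rat.HeightOneSpectrum.natGenerator v = (pp : ℕ) →
          4 * l ≤ (l - 3) * (-(ord ℚ v (Cor22.jInv q))).toNat →
          haveI : Fact (pp : ℕ).Prime := ⟨pp.2⟩
          ∃ x₀ : (thetaIndex (pilotDataOfK T.D T.K)).Fibre (.inr pp),
            absRamificationIdx (pp : ℕ) (kOf (pilotDataOfK T.D T.K) pp.1 x₀) ≤ (pp : ℕ) - 2) :
    letI := T.instFieldF; letI := T.instNumberFieldF; letI := T.instAlgebraF; letI := T.instFieldK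
    letI := T.instNumberFieldK; letI := T.instAlgebraK; letI := T.instFieldFbar; letI := T.instAlgebraFbar
    letI := T.instAlgebraKFbar; letI := T.instIsElliptic
    ∀ (M : Type) [Field M] [NumberField M]
      (archPk : ∀ (j : (thetaIndex (pilotDataOfK T.D T.K)).Label) (vQ : (thetaIndex (pilotDataOfK T.D T.K)).VQ),
        Set ((logShellsDH (pilotDataOfK T.D T.K) (analyticLogv T.K)).Packet j vQ))
      (archSub : ∀ (j : (thetaIndex (pilotDataOfK T.D T.K)).Label) (v : (thetaIndex (pilotDataOfK T.D T.K)).V),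
        Set ((logShellsDH (pilotDataOfK T.D T.K) (analyticLogv T.K)).Packet j ((thetaIndex (pilotDataOfK T.D T.K)).over v)))
      (Ψ : ℤ → ∀ v : (thetaIndex (pilotDataOfK T.D T.K)).V, v ∈ (thetaIndex (pilotDataOfK T.D T.K)).Vbad →
        Set ((logShellsDH (pilotDataOfK T.D T.K) (analyticLogv T.K)).StarPacket v))
      (act : ℤ → ∀ v : (thetaIndex (pilotDataOfK T.D T.K)).V, v ∈ (thetaIndex (pilotDataOfK T.D T.K)).Vbad →
        (logShellsDH (pilotDataOfK T.D T.K) (analyticLogv T.K)).StarPacket v →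
          Module.End ℚ ((logShellsDH (pilotDataOfK T.D T.K) (analyticLogv T.K)).StarPacket v))
      (Mmod : ℤ → ∀ j : (thetaIndex (pilotDataOfK T.D T.K)).LabelStar, Set ((logShellsDH (pilotDataOfK T.D T.K) (analyticLogv T.K)).GlobalPacket j.1))
      (region : ℤ → ∀ j : (thetaIndex (pilotDataOfK T.D T.K)).LabelStar, FinDivisor M → ∀ vQ : (thetaIndex (pilotDataOfK T.D T.K)).VQ,
        Set ((logShellsDH (pilotDataOfK T.D T.K) (analyticLogv T.K)).Packet j.1 vQ))
      (frobAdm : ℤ → ℤ → ∀ (j : (thetaIndex (pilotDataOfK T.D T.K)).Label) (vQ : (thetaIndex (pilotDataOfK T.D T.K)).VQ),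
        Set ((logShellsDH (pilotDataOfK T.D T.K) (analyticLogv T.K)).Packet j vQ) → Prop)
      (frobLogvol : ℤ → ℤ → ∀ (j : (thetaIndex (pilotDataOfK T.D T.K)).Label) (vQ : (thetaIndex (pilotDataOfK T.D T.K)).VQ),
        Set ((logShellsDH (pilotDataOfK T.D T.K) (analyticLogv T.K)).Packet j vQ) → ℝ)
      (frobΨ : ℤ → ℤ → ∀ v : (thetaIndex (pilotDataOfK T.D T.K)).V, v ∈ (thetaIndex (pilotDataOfK T.D T.K)).Vbad →
        Set ((logShellsDH (pilotDataOfK T.D T.K) (analyticLogv T.K)).StarPacket v))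
      (frobMmod : ℤ → ℤ → ∀ j : (thetaIndex (pilotDataOfK T.D T.K)).LabelStar, Set ((logShellsDH (pilotDataOfK T.D T.K) (analyticLogv T.K)).GlobalPacket j.1))
      (unitImage : ℤ → ℤ → ℕ → ∀ (j : (thetaIndex (pilotDataOfK T.D T.K)).Label) (vQ : (thetaIndex (pilotDataOfK T.D T.K)).VQ),
        Set ((logShellsDH (pilotDataOfK T.D T.K) (analyticLogv T.K)).Packet j vQ))
      (ballImage : ℤ → ℤ → ∀ (j : (thetaIndex (pilotDataOfK T.D T.K)).Label) (vQ : (thetaIndex (pilotDataOfK T.D T.K)).VQ),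
        Set ((logShellsDH (pilotDataOfK T.D T.K) (analyticLogv T.K)).Packet j vQ))
      (thetaDiv : ℤ → ℤ → LgpDivisor M (thetaIndex (pilotDataOfK T.D T.K)).lstar)
      (n : ℤ) {HT : Type} {LogLink : HT → HT → Type} {IsFull : ∀ {s t : HT}, LogLink s t → Prop}
      (lat : LGPGaussianLogThetaLattice LogLink IsFull)
      {Frd : Type} {IsoF : Frd → Frd → Type} {Ob : Frd → Type} {realify : Frd → Frd} {Strip : Type}
      {IsoS : Strip → Strip → Type} {Mv : ∀ v : (thetaIndex (pilotDataOfK T.D T.K)).V, v ∈ (thetaIndex (pilotDataOfK T.D T.K)).Vbad → Type}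
      [∀ v h, Monoid (Mv v h)]
      (sig : GlobalLGPFrobenioidSignature (thetaIndex (pilotDataOfK T.D T.K)).lstar (thetaIndex (pilotDataOfK T.D T.K)).V
        (· ∈ (thetaIndex (pilotDataOfK T.D T.K)).Vbad) Frd IsoF Ob realify Strip IsoS Mv)
      (split : SplittingMonoids Mv) {ObΔ : Type} {N : ∀ v : (thetaIndex (pilotDataOfK T.D T.K)).V, v ∈ (thetaIndex (pilotDataOfK T.D T.K)).Vbad → Type}
      [∀ v h, Monoid (N v h)] (qData : QPilotData ObΔ N)
      (qK : ∀ v : (thetaIndex (pilotDataOfK T.D T.K)).V, v ∈ (thetaIndex (pilotDataOfK T.D T.K)).Vbad →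
        Set ((logShellsDH (pilotDataOfK T.D T.K) (analyticLogv T.K)).StarPacket v)),
      ¬ Cor312Vol.PilotKummerCompatHull
          (LatticeSituation.ofShells (logShellsDH (pilotDataOfK T.D T.K) (analyticLogv T.K)) M archPk archSub
            (summandPiecesPr (pilotDataOfK T.D T.K) (logvAnalytic_analyticLogv (F := T.K))).Adm
            (summandPiecesPr (pilotDataOfK T.D T.K) (logvAnalytic_analyticLogv (F := T.K))).logvol Ψ act Mmod region frobAdm frobLogvol frobΨ
            frobMmod unitImage ballImage thetaDiv)
          (settingPrVolSharp (pilotDataOfK T.D T.K) (logvAnalytic_analyticLogv (F := T.K)) M archPk archSub Ψ act Mmod region n lat sig split qData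
            (exists_realising_qIdeles_pilotDataOfK T.D).choose (exists_realising_thetaIdeles_pilotDataOfK T.D).choose
            (exists_realising_qIdeles_pilotDataOfK T.D).choose_spec.1 (exists_realising_qIdeles_pilotDataOfK T.D).choose_spec.2.1)
          (fun _ => Cor312.Setting.qRegion
            (settingPrVolSharp (pilotDataOfK T.D T.K) (logvAnalytic_analyticLogv (F := T.K)) M archPk archSub Ψ act Mmod region n lat sig split qData
              (exists_realising_qIdeles_pilotDataOfK T.D).choose (exists_realising_thetaIdeles_pilotDataOfK T.D).choose
              (exists_realising_qIdeles_pilotDataOfK T.D).choose_spec.1 (exists_realising_qIdeles_pilotDataOfK T.D).choose_spec.2.1)) qK := by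
  classical
  letI := T.instFieldF; letI := T.instNumberFieldF; letI := T.instAlgebraF; letI := T.instFieldK
  letI := T.instNumberFieldK; letI := T.instAlgebraK; letI := T.instFieldFbar; letI := T.instAlgebraFbar
  letI := T.instAlgebraKFbar; letI := T.instIsElliptic
  intro M _ _ archPk archSub Ψ act Mmod region frobAdm frobLogvol frobΨ frobMmod unitImage ballImage thetaDiv n HT LogLink IsFull lat
    Frd IsoF Ob realify Strip IsoS Mv _ sig split ObΔ N _ qData qK
  -- the heavy bad place `v ∤ 2l` of `λ`, of order `h ≥ 1` with `4l ≤ (l−3)·h`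
  obtain ⟨v, hv, h2, hl, hordv, hh, h4⟩ := Cor22.exists_heavy_badPlace_of_szpiroBad_ratPoint q h7 hbad
  set h : ℕ := (-(ord ℚ v (Cor22.jInv q))).toNat with hhdef
  -- its prime `p ∉ {2, l}`
  set pp : Nat.Primes := ⟨Rat.HeightOneSpectrum.natGenerator v, Rat.HeightOneSpectrum.prime_natGenerator v⟩ with hppdef
  haveI : Fact (pp : ℕ).Prime := ⟨pp.2⟩
  have hgen : Rat.HeightOneSpectrum.natGenerator v = (pp : ℕ) := rfl
  have hp2 : (pp : ℕ) ≠ 2 := by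
    intro h2'
    exact h2 ((Literature.NumberTheory.DiophantineGeometry.UniformABCConjecture.natCast_mem_asIdeal_iff v 2).mpr (by rw [hgen, h2']))
  have hpl : (pp : ℕ) ≠ l := by
    intro hl'
    exact hl ((Literature.NumberTheory.DiophantineGeometry.UniformABCConjecture.natCast_mem_asIdeal_iff v l).mpr (by rw [hgen, hl']))
  -- the pole order at EVERY place of `ℚ` over `p` (there is only `v`)
  have hord : ∀ u : HeightOneSpectrum (𝓞 ℚ), Rat.HeightOneSpectrum.natGenerator u = (pp : ℕ) →
      ord ℚ u (Cor22.jInv q) ≤ -(h : ℤ) := by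
    intro u hu
    have huv : u = v :=
      (Rat.HeightOneSpectrum.primesEquiv (R := 𝓞 ℚ)).injective (Subtype.ext (hu.trans hgen.symm))
    rw [huv, hordv]
  -- the lattice-tame place over `p` (the binder), then abc-iut-w5-d107's top-label robust decider
  obtain ⟨x₀, hx₀⟩ := htame pp hp2 hpl v hv hgen h4
  exact GenuineK.not_pilotKummerCompatHull_chosen_ratPoint_of_tame_robust_top T pp hp2 hpl h hh hord h4 x₀ hx₀ M archPk archSub Ψ act
    Mmod region frobAdm frobLogvol frobΨ frobMmod unitImage ballImage thetaDiv n lat sig split qData qK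

/-! ## §4. The binder discharged at large heavy primes: NO datum at such a Szpiro-bad rational `(λ, l ≥ 7)` carries S_H -/

/-- **UNCONDITIONAL LARGE-HEAVY-PRIME FORM.** `λ ∈ ℚ`, `7 ≤ l`, `(ratPoint λ, l)` Szpiro-bad; suppose every HEAVY bad prime `p ∉ {2, l}` of `λ`
(a pole `v` of `j(λ)` with `4l ≤ (l−3)·h_v`) satisfies `46080·l ≤ p − 2`. Then EVERY place of `T.K` over the heavy prime of §2 is
lattice-tame by abc-iut-w5-d163's `GenuineK.absRamificationIdx_kOf_le_ratPoint` (`e(K_x/ℚ_p) ≤ 46080·l`, p457581), so the local-type binder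
of §3 is DISCHARGED: the hull-level clause S_H FAILS at EVERY genuine Θ-volume datum over `(ratPoint λ, l)`, for every choice of the free
binders — a hypothesis on `(λ, l)` alone. [cite: Mochizuki2012, IUTchIV Prop. 1.8 (vii) p. 20, Cor. 2.2 (ii) proof (P5) p. 46; IUTchIII Cor. 3.12 Step (xi-f) p. 184]
[claim: Mochizuki2012, status: disputed] -/
theorem GenuineK.not_pilotKummerCompatHull_chosen_ratPoint_of_szpiroBad_of_large_heavy_primes {q : ℚ} {l : ℕ}
    (T : Cor22.ThetaVolumeDatumAt (ratPoint q) l) (h7 : 7 ≤ l)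
    (hbad : ((l : ℝ) + 5) / 4 < (Cor22.dmod (ratPoint q) : ℝ) ∨
        6 * l * (((l : ℝ) + 5) - 4 * Cor22.dmod (ratPoint q)) / (((l : ℝ) + 4) * ((l : ℝ) - 3))
            * ((ratPoint q).logDiff + (1 - 1 / (l : ℝ)) * Cor22.logCondAvoid (ratPoint q) {2, l})
          + 6 * l * ((l : ℝ) + 5) / (((l : ℝ) + 4) * ((l : ℝ) - 3)) * Real.log Real.pi < Cor22.logQAvoid (ratPoint q) {2, l})
    (hbig : ∀ v : HeightOneSpectrum (𝓞 ℚ), v ∈ Cor22.badPlaces (ratPoint q) →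
      Rat.HeightOneSpectrum.natGenerator v ≠ 2 → Rat.HeightOneSpectrum.natGenerator v ≠ l →
      4 * l ≤ (l - 3) * (-(ord ℚ v (Cor22.jInv q))).toNat → 46080 * l ≤ Rat.HeightOneSpectrum.natGenerator v - 2) :
    letI := T.instFieldF; letI := T.instNumberFieldF; letI := T.instAlgebraF; letI := T.instFieldK
    letI := T.instNumberFieldK; letI := T.instAlgebraK; letI := T.instFieldFbar; letI := T.instAlgebraFbar
    letI := T.instAlgebraKFbar; letI := T.instIsElliptic
    ∀ (M : Type) [Field M] [NumberField M]
      (archPk : ∀ (j : (thetaIndex (pilotDataOfK T.D T.K)).Label) (vQ : (thetaIndex (pilotDataOfK T.D T.K)).VQ),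
        Set ((logShellsDH (pilotDataOfK T.D T.K) (analyticLogv T.K)).Packet j vQ))
      (archSub : ∀ (j : (thetaIndex (pilotDataOfK T.D T.K)).Label) (v : (thetaIndex (pilotDataOfK T.D T.K)).V),
        Set ((logShellsDH (pilotDataOfK T.D T.K) (analyticLogv T.K)).Packet j ((thetaIndex (pilotDataOfK T.D T.K)).over v)))
      (Ψ : ℤ → ∀ v : (thetaIndex (pilotDataOfK T.D T.K)).V, v ∈ (thetaIndex (pilotDataOfK T.D T.K)).Vbad →
        Set ((logShellsDH (pilotDataOfK T.D T.K) (analyticLogv T.K)).StarPacket v))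
      (act : ℤ → ∀ v : (thetaIndex (pilotDataOfK T.D T.K)).V, v ∈ (thetaIndex (pilotDataOfK T.D T.K)).Vbad →
        (logShellsDH (pilotDataOfK T.D T.K) (analyticLogv T.K)).StarPacket v →
          Module.End ℚ ((logShellsDH (pilotDataOfK T.D T.K) (analyticLogv T.K)).StarPacket v))
      (Mmod : ℤ → ∀ j : (thetaIndex (pilotDataOfK T.D T.K)).LabelStar, Set ((logShellsDH (pilotDataOfK T.D T.K) (analyticLogv T.K)).GlobalPacket j.1))
      (region : ℤ → ∀ j : (thetaIndex (pilotDataOfK T.D T.K)).LabelStar, FinDivisor M → ∀ vQ : (thetaIndex (pilotDataOfK T.D T.K)).VQ,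
        Set ((logShellsDH (pilotDataOfK T.D T.K) (analyticLogv T.K)).Packet j.1 vQ))
      (frobAdm : ℤ → ℤ → ∀ (j : (thetaIndex (pilotDataOfK T.D T.K)).Label) (vQ : (thetaIndex (pilotDataOfK T.D T.K)).VQ),
        Set ((logShellsDH (pilotDataOfK T.D T.K) (analyticLogv T.K)).Packet j vQ) → Prop)
      (frobLogvol : ℤ → ℤ → ∀ (j : (thetaIndex (pilotDataOfK T.D T.K)).Label) (vQ : (thetaIndex (pilotDataOfK T.D T.K)).VQ),
        Set ((logShellsDH (pilotDataOfK T.D T.K) (analyticLogv T.K)).Packet j vQ) → ℝ)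
      (frobΨ : ℤ → ℤ → ∀ v : (thetaIndex (pilotDataOfK T.D T.K)).V, v ∈ (thetaIndex (pilotDataOfK T.D T.K)).Vbad →
        Set ((logShellsDH (pilotDataOfK T.D T.K) (analyticLogv T.K)).StarPacket v))
      (frobMmod : ℤ → ℤ → ∀ j : (thetaIndex (pilotDataOfK T.D T.K)).LabelStar, Set ((logShellsDH (pilotDataOfK T.D T.K) (analyticLogv T.K)).GlobalPacket j.1))
      (unitImage : ℤ → ℤ → ℕ → ∀ (j : (thetaIndex (pilotDataOfK T.D T.K)).Label) (vQ : (thetaIndex (pilotDataOfK T.D T.K)).VQ),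
        Set ((logShellsDH (pilotDataOfK T.D T.K) (analyticLogv T.K)).Packet j vQ))
      (ballImage : ℤ → ℤ → ∀ (j : (thetaIndex (pilotDataOfK T.D T.K)).Label) (vQ : (thetaIndex (pilotDataOfK T.D T.K)).VQ),
        Set ((logShellsDH (pilotDataOfK T.D T.K) (analyticLogv T.K)).Packet j vQ))
      (thetaDiv : ℤ → ℤ → LgpDivisor M (thetaIndex (pilotDataOfK T.D T.K)).lstar)
      (n : ℤ) {HT : Type} {LogLink : HT → HT → Type} {IsFull : ∀ {s t : HT}, LogLink s t → Prop}
      (lat : LGPGaussianLogThetaLattice LogLink IsFull)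
      {Frd : Type} {IsoF : Frd → Frd → Type} {Ob : Frd → Type} {realify : Frd → Frd} {Strip : Type}
      {IsoS : Strip → Strip → Type} {Mv : ∀ v : (thetaIndex (pilotDataOfK T.D T.K)).V, v ∈ (thetaIndex (pilotDataOfK T.D T.K)).Vbad → Type}
      [∀ v h, Monoid (Mv v h)]
      (sig : GlobalLGPFrobenioidSignature (thetaIndex (pilotDataOfK T.D T.K)).lstar (thetaIndex (pilotDataOfK T.D T.K)).V
        (· ∈ (thetaIndex (pilotDataOfK T.D T.K)).Vbad) Frd IsoF Ob realify Strip IsoS Mv)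
      (split : SplittingMonoids Mv) {ObΔ : Type} {N : ∀ v : (thetaIndex (pilotDataOfK T.D T.K)).V, v ∈ (thetaIndex (pilotDataOfK T.D T.K)).Vbad → Type}
      [∀ v h, Monoid (N v h)] (qData : QPilotData ObΔ N)
      (qK : ∀ v : (thetaIndex (pilotDataOfK T.D T.K)).V, v ∈ (thetaIndex (pilotDataOfK T.D T.K)).Vbad →
        Set ((logShellsDH (pilotDataOfK T.D T.K) (analyticLogv T.K)).StarPacket v)),
      ¬ Cor312Vol.PilotKummerCompatHull
          (LatticeSituation.ofShells (logShellsDH (pilotDataOfK T.D T.K) (analyticLogv T.K)) M archPk archSub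
            (summandPiecesPr (pilotDataOfK T.D T.K) (logvAnalytic_analyticLogv (F := T.K))).Adm
            (summandPiecesPr (pilotDataOfK T.D T.K) (logvAnalytic_analyticLogv (F := T.K))).logvol Ψ act Mmod region frobAdm frobLogvol frobΨ
            frobMmod unitImage ballImage thetaDiv)
          (settingPrVolSharp (pilotDataOfK T.D T.K) (logvAnalytic_analyticLogv (F := T.K)) M archPk archSub Ψ act Mmod region n lat sig split qData
            (exists_realising_qIdeles_pilotDataOfK T.D).choose (exists_realising_thetaIdeles_pilotDataOfK T.D).choose
            (exists_realising_qIdeles_pilotDataOfK T.D).choose_spec.1 (exists_realising_qIdeles_pilotDataOfK T.D).choose_spec.2.1)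
          (fun _ => Cor312.Setting.qRegion
            (settingPrVolSharp (pilotDataOfK T.D T.K) (logvAnalytic_analyticLogv (F := T.K)) M archPk archSub Ψ act Mmod region n lat sig split qData
              (exists_realising_qIdeles_pilotDataOfK T.D).choose (exists_realising_thetaIdeles_pilotDataOfK T.D).choose
              (exists_realising_qIdeles_pilotDataOfK T.D).choose_spec.1 (exists_realising_qIdeles_pilotDataOfK T.D).choose_spec.2.1)) qK := by
  letI := T.instFieldF; letI := T.instNumberFieldF; letI := T.instAlgebraF; letI := T.instFieldK
  letI := T.instNumberFieldK; letI := T.instAlgebraK; letI := T.instFieldFbar; letI := T.instAlgebraFbar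
  letI := T.instAlgebraKFbar; letI := T.instIsElliptic
  refine GenuineK.not_pilotKummerCompatHull_chosen_ratPoint_of_szpiroBad_tame T h7 hbad ?_
  intro pp hp2 hpl v hv hgen h4
  haveI : Fact (pp : ℕ).Prime := ⟨pp.2⟩
  have hle : 46080 * l ≤ (pp : ℕ) - 2 := by
    rw [← hgen]
    exact hbig v hv (by rw [hgen]; exact hp2) (by rw [hgen]; exact hpl) h4
  obtain ⟨x, hx⟩ := (thetaIndex (pilotDataOfK T.D T.K)).fibre_nonempty (.inr pp)
  exact ⟨⟨x, hx⟩, (GenuineK.absRamificationIdx_kOf_le_ratPoint T pp hp2 hpl ⟨x, hx⟩).trans hle⟩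

end Summit.ABC.IUTFork.Conditional

end
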